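import Summits.CriticalPhenomena.PercolationContinuityZ3.Theorems.PercNearOneGluingNoHeavyLowerTailKNGoodGCThreeTwinSymm
import Summits.CriticalPhenomena.PercolationContinuityZ3.Theorems.PercNearOneGluingNoHeavyLowerTailKNGoodSeriesGlue
import HarnessLib

/-!
# Removing a sure pendant twin of the observer from the goodness functional
# (`NoHeavyLowerTail` cell, stmt-CriticalPhenomena-4575; prover `prim-hp-2`, deletion–contraction line, gen 12)

Support file (`--supports stmt-CriticalPhenomena-4575`).  No definitions, no named facts, no sorries.
Memo: `run/shared/lean/prim/prim-hp-2/MEMO-gen12-gc-three-relays.md` §7 (end of phase 2 of the assembly plan for the three-relay GC).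

If the observer `x` has a SURE pendant twin `y` (the pair `s(x,y)` has weight `1` and every other pair at `y` weight `0`), then `y` can be
deleted without changing Kozma–Nitzan's goodness functional with explicit witness:

* `KNGoodGC3.agood_kill_pendantTwin` — `agood(u, x; j) = agood(u ∖ y, x; j)` where `u ∖ y = pinW u {pairs at y} ∅`.
  Proof: read the functional at `y` (`agood_twin_symm`), recognise `u` as `(u ∖ y)[s(y,x) ↦ 1]`, and apply the corner transport
  `KNGoodSeriesGlue.agood_wzero_glue_one` (the observer glued into `x` is the observer `x` of the graph without it).
After `agood_affine_pair_twin` (expansion in the twin's hairs) and `agood_update_surePath` (moving the twin's sure hairs onto `x`) this turns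
the glued two-star observer of `hGC` into a ONE-layer observer, to which `KNGoodTwoTwo.agood_oneLayer_ge` applies.
[cite: KozmaNitzan2024, §3.2 Definition (p. 12), proof of Thm. 5 (pp. 13–14)]
-/

noncomputable section

namespace Summit.CriticalPhenomena.PercolationContinuityZ3.Theorems

open MeasureTheory Set Literature.Probability.LatticeModels Literature.Probability.Percolation
open scoped Classical BigOperators

variable {n : ℕ}

namespace KNGoodGC3

open ChampionStability KNGoodAux KNGoodHair KNGoodSeries KNGoodPortFree

/-- A vertex whose only positive pair is the sure pair to `x` is `(u ∖ y)[s(y,x) ↦ 1]`. [folklore] -/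
theorem eq_update_pinW_of_pendantTwin (u : Sym2 (Fin n) → unitInterval) {x y : Fin n} (_hxy : x ≠ y)
    (hsure : u s(x, y) = 1) (hiso : ∀ z : Fin n, z ≠ y → z ≠ x → u s(y, z) = 0) :
    u = Function.update (pinW u {e : Sym2 (Fin n) | y ∈ e ∧ ¬ e.IsDiag} ∅) s(y, x) 1 := by
  funext e
  by_cases he : e = s(y, x)
  · subst he
    rw [Function.update_self, Sym2.eq_swap, hsure]
  · rw [Function.update_of_ne he]
    by_cases hmem : e ∈ {e : Sym2 (Fin n) | y ∈ e ∧ ¬ e.IsDiag}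
    · rw [pinW_apply_of_mem_of_not_mem u hmem (Set.notMem_empty e)]
      obtain ⟨hy, hdiag⟩ := hmem
      have hoth := Sym2.other_spec hy
      set z := Sym2.Mem.other hy with hz
      have hzy : z ≠ y := by
        intro h
        apply hdiag
        rw [← hoth, h]
        exact Sym2.mk_isDiag_iff.2 rfl
      have hzx : z ≠ x := by
        intro h
        apply he
        rw [← hoth, h]
      rw [← hoth]
      exact hiso z hzy hzx
    · rw [pinW_apply_of_not_mem u ∅ hmem]

/-- **Removing a sure pendant twin.**  `x ≠ y`, `y ∉ A`, `j ∈ A`, `b ≠ y`, `u s(x,y) = 1`, every other pair at `y` of weight `0`: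
`agood(u, x; j) = agood(pinW u {pairs at y} ∅, x; j)`. [cite: KozmaNitzan2024, §3.2 Definition (p. 12), Thm. 5 (pp. 13–14)] -/
theorem agood_kill_pendantTwin (u : Sym2 (Fin n) → unitInterval) (A : Finset (Fin n)) (hA : A.Nonempty) {x y : Fin n} (j b : Fin n)
    (hxy : x ≠ y) (hyA : y ∉ A) (hjA : j ∈ A) (hby : b ≠ y)
    (hsure : u s(x, y) = 1) (hiso : ∀ z : Fin n, z ≠ y → z ≠ x → u s(y, z) = 0) :
    (prodBernoulli u).real (openConn x b) - (prodBernoulli u).real (openConn j b) +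
        ∑ W ∈ nullSets A, (prodBernoulli u).real (clusterIs x W) *
          A.inf' hA (fun a' => (prodBernoulli u).real (openConnIn ((↑W : Set (Fin n))ᶜ) a' b)) =
      (prodBernoulli (pinW u {e : Sym2 (Fin n) | y ∈ e ∧ ¬ e.IsDiag} ∅)).real (openConn x b) -
        (prodBernoulli (pinW u {e : Sym2 (Fin n) | y ∈ e ∧ ¬ e.IsDiag} ∅)).real (openConn j b) +
        ∑ W ∈ nullSets A, (prodBernoulli (pinW u {e : Sym2 (Fin n) | y ∈ e ∧ ¬ e.IsDiag} ∅)).real (clusterIs x W) *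
          A.inf' hA (fun a' => (prodBernoulli (pinW u {e : Sym2 (Fin n) | y ∈ e ∧ ¬ e.IsDiag} ∅)).real
            (openConnIn ((↑W : Set (Fin n))ᶜ) a' b)) := by
  rw [agood_twin_symm u A hA hxy hsure j b]
  have hu := eq_update_pinW_of_pendantTwin u hxy hsure hiso
  have hpin : pinW u {e : Sym2 (Fin n) | y ∈ e ∧ ¬ e.IsDiag} ∅ =
      pinW (Function.update (pinW u {e : Sym2 (Fin n) | y ∈ e ∧ ¬ e.IsDiag} ∅) s(y, x) 1)
        {e : Sym2 (Fin n) | y ∈ e ∧ ¬ e.IsDiag} ∅ := by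
    rw [← hu]
  have key := agood_wzero_glue_one (pinW u {e : Sym2 (Fin n) | y ∈ e ∧ ¬ e.IsDiag} ∅) A hA y x j b hyA hxy hjA hby
  have hidem : pinW (pinW u {e : Sym2 (Fin n) | y ∈ e ∧ ¬ e.IsDiag} ∅) {e : Sym2 (Fin n) | y ∈ e ∧ ¬ e.IsDiag} ∅ =
      pinW u {e : Sym2 (Fin n) | y ∈ e ∧ ¬ e.IsDiag} ∅ := by
    funext e
    by_cases hmem : e ∈ {e : Sym2 (Fin n) | y ∈ e ∧ ¬ e.IsDiag}
    · rw [pinW_apply_of_mem_of_not_mem _ hmem (Set.notMem_empty e), pinW_apply_of_mem_of_not_mem _ hmem (Set.notMem_empty e)]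
    · rw [pinW_apply_of_not_mem _ ∅ hmem]
  rw [hidem] at key
  conv_lhs => rw [hu]
  exact key

end KNGoodGC3

end Summit.CriticalPhenomena.PercolationContinuityZ3.Theorems

end
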